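import Summits.Ventures.CertifiedManyBodySolver.Upper.DWaveSourceOpenClusterCap
import Literature.MathematicalPhysics.QuantumLattice.DWaveSourceNNNHopping
import HarnessLib

/-!
# Cluster trial states for the pinning-field rows, part 5: the VECTOR-LEVEL trial rows of the tiled
# product state (norm, particle number, sourced energy) in the `hrows` interface shape

HONEST FRAMING: first certified bounds; not a superconductivity verdict; every number certified or
labelled float. Nothing in this file is a number: it exports exact identities of an explicit trial vector.

Companion of `Upper/DWaveSourceOpenClusterCap.lean` (seat hubbard-obs-pin-1; interface requested by hubbard-cq
p2 g2 / obsth-3 g2, pub/hubbard-cq/INBOX 20:22Z / 20:30Z / 20:57Z). For an EVEN unit cluster vector `φ` of the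
open sourced `a × b` cluster and every torus side `L = Kx a = Ky b` with `a, b < L`, the tiled product
`Ψ_L = ⊗_R φ` (`(rectBlockPartition hLa hLb).prodFamily fun _ => φ`) satisfies the three EXACT rows

  (1) `star Ψ_L ⬝ᵥ Ψ_L = 1`,
  (2) `⟨Ψ_L, N Ψ_L⟩ = Kx Ky · ⟨φ, N_C φ⟩`            (`expect_prodFamily_totalNumber`),
  (3) `⟨Ψ_L, A_L(μ,h) Ψ_L⟩ = Kx Ky · ⟨φ, A_C(μ,h) φ⟩`  (part 4, `expect_prodFamily_dWaveSourceTorus`),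

(2) being (3) at two chemical potentials (`A(μ − 1) − A(μ) = N` on the torus and on the cluster). Packaged per
admissible side in the `hrows` shape consumed BY NAME by
`exists_isTranslationInvariant_density_eq_meanEnergy_sourced_eq_of_periodic_trialStates` (p2,
`PairSourcedTorusTrialStateLimit`, canonical / TI class) and `sourcedEnergyUpperRow_of_hrows[_self|_zero]` (obsth-3,
`Observables/PinningFieldTangentChord`, GC class at every `μ`):

* `periodicTrialRows_of_clusterState` — `∀ L, q ∣ L → L₀ ≤ L → ∀ [NeZero L], ∃ ψ, star ψ ⬝ᵥ ψ = 1 ∧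
  (expect totalNumber ψ).re = n·L² ∧ (expect (dWaveSourceTorusTT' L 0 U μ h) ψ).re = e·L²` with the REAL slots
  `n = Re⟨φ, N_C φ⟩/(ab)`, `e = Re⟨φ, A_C φ⟩/(ab)` (`a ∣ q`, `b ∣ q`, `a, b < L₀`);
* `periodicTrialRows_of_clusterState_rat` — the same with RATIONAL slots `n, e : ℚ` given
  `Re⟨φ, N_C φ⟩ = n·(ab)`, `Re⟨φ, A_C φ⟩ = e·(ab)` (the shape a certificate prints), at `μ = ((μ₀ : ℚ) : ℝ)`.

References: D. Ruelle, *Statistical Mechanics: Rigorous Results* (1969) §3.3–3.4 (periodic trial states and the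
variational principle at fixed mean density); T. Koma, H. Tasaki, J. Stat. Phys. 76 (1994) 745, §1. Tree: parts 1–4,
`dWaveSourceTorusTT'_zero_tp` (`DWaveSourceNNNHopping`), `expect` (`HubbardWave0`).
-/

noncomputable section

namespace Summit.Ventures.CertifiedManyBodySolver

open Matrix Literature.Probability.LatticeModels
open Literature.MathematicalPhysics.QuantumLattice Literature.MathematicalPhysics.QuantumLattice.ThermodynamicLimit
open Literature.MathematicalPhysics.QuantumLattice.TwoCluster Literature.Barriers.HubbardSuperconductivity
open TorusRectBlock ClusterParity
open scoped ComplexOrder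

/-! ### Chemical-potential differences are the particle number -/

/-- `A_C(U, μ, h) − A_C(U, μ', h) = (μ' − μ) · N` on the open sourced cluster. [folklore] -/
theorem dWaveSourceOpenBox_sub_dWaveSourceOpenBox (a b : ℕ) (U μ μ' h : ℝ) :
    dWaveSourceOpenBox a b U μ h - dWaveSourceOpenBox a b U μ' h = ((μ' - μ : ℝ) : ℂ) • totalNumber := by
  unfold dWaveSourceOpenBox
  rw [hamiltonianWith_eq, hamiltonianWith_eq]
  push_cast
  rw [sub_smul]
  abel

/-- `A_L(U, μ, h) − A_L(U, μ', h) = (μ' − μ) · N` on the sourced torus. [folklore] -/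
theorem dWaveSourceTorus_sub_dWaveSourceTorus (L : ℕ) [NeZero L] (U μ μ' h : ℝ) :
    dWaveSourceTorus L U μ h - dWaveSourceTorus L U μ' h = ((μ' - μ : ℝ) : ℂ) • totalNumber := by
  unfold dWaveSourceTorus
  rw [hubbardTorusWith_eq, hubbardTorusWith_eq]
  push_cast
  rw [sub_smul]
  abel

/-! ### The particle-number row of the tiled product state -/

section Rows

variable {L Kx Ky a b : ℕ} (hLa : L = Kx * a) (hLb : L = Ky * b)

/-- **The particle-number row**: `⟨⊗_R φ, N ⊗_R φ⟩ = Kx Ky ⟨φ, N_C φ⟩` for an even unit cluster vector `φ`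
(`L = Kx a = Ky b`, `a, b < L`). [cite: Ruelle1969, §3.3] -/
theorem expect_prodFamily_totalNumber [NeZero L] (haL : a < L) (hbL : b < L)
    {φ : Fock (Orb (Fin a ×ₗ Fin b))} (hφ : HasParity 0 φ) (hφ1 : star φ ⬝ᵥ φ = 1) :
    star ((rectBlockPartition hLa hLb).prodFamily fun _ => φ) ⬝ᵥ
        (totalNumber *ᵥ (rectBlockPartition hLa hLb).prodFamily fun _ => φ) =
      ((Kx * Ky : ℕ) : ℂ) * (star φ ⬝ᵥ (totalNumber *ᵥ φ)) := by
  have hT : (totalNumber : Matrix (Finset (Orb (FermionTorus 2 L))) (Finset (Orb (FermionTorus 2 L))) ℂ) =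
      dWaveSourceTorus L 0 (-1) 0 - dWaveSourceTorus L 0 0 0 := by
    rw [dWaveSourceTorus_sub_dWaveSourceTorus]; norm_num
  have hC : (totalNumber : Matrix (Finset (Orb (Fin a ×ₗ Fin b))) (Finset (Orb (Fin a ×ₗ Fin b))) ℂ) =
      dWaveSourceOpenBox a b 0 (-1) 0 - dWaveSourceOpenBox a b 0 0 0 := by
    rw [dWaveSourceOpenBox_sub_dWaveSourceOpenBox]; norm_num
  rw [hT, hC, sub_mulVec, dotProduct_sub, sub_mulVec, dotProduct_sub,
    expect_prodFamily_dWaveSourceTorus hLa hLb haL hbL 0 (-1) 0 hφ hφ1,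
    expect_prodFamily_dWaveSourceTorus hLa hLb haL hbL 0 0 0 hφ hφ1, mul_sub]

/-- The three rows of the tiled product state on ONE admissible torus, real parts, per site of the cluster:
`‖Ψ‖ = 1`, `Re⟨Ψ, NΨ⟩ = (Re⟨φ, N_Cφ⟩/(ab))·L²`, `Re⟨Ψ, A_L(0-tp; μ, h)Ψ⟩ = (Re⟨φ, A_Cφ⟩/(ab))·L²`.
[cite: Ruelle1969, §3.3] -/
theorem trialRows_prodFamily [NeZero L] (haL : a < L) (hbL : b < L) (U μ h : ℝ)
    {φ : Fock (Orb (Fin a ×ₗ Fin b))} (hφ : HasParity 0 φ) (hφ1 : star φ ⬝ᵥ φ = 1) :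
    star ((rectBlockPartition hLa hLb).prodFamily fun _ => φ) ⬝ᵥ ((rectBlockPartition hLa hLb).prodFamily fun _ => φ) = 1 ∧
      (expect totalNumber ((rectBlockPartition hLa hLb).prodFamily fun _ => φ)).re =
        (expect totalNumber φ).re / ((a : ℝ) * b) * (L : ℝ) ^ 2 ∧
      (expect (dWaveSourceTorusTT' L 0 U μ h) ((rectBlockPartition hLa hLb).prodFamily fun _ => φ)).re =
        (expect (dWaveSourceOpenBox a b U μ h) φ).re / ((a : ℝ) * b) * (L : ℝ) ^ 2 := by
  have ha : 0 < a := side_pos_of_eq hLa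
  have hb : 0 < b := side_pos_of_eq hLb
  have hab : ((a : ℝ) * b) ≠ 0 := by positivity
  have hL2 : ((L : ℝ)) ^ 2 = ((Kx * Ky : ℕ) : ℝ) * ((a : ℝ) * b) := by
    rw [sq]
    nth_rewrite 1 [hLa]
    rw [hLb]
    push_cast
    ring
  have hcast : ((Kx * Ky : ℕ) : ℂ) = (((Kx * Ky : ℕ) : ℝ) : ℂ) := by norm_cast
  refine ⟨?_, ?_, ?_⟩
  · rw [(rectBlockPartition hLa hLb).star_prodFamily_dotProduct_prodFamily]
    exact Finset.prod_eq_one fun _ _ => hφ1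
  · unfold expect
    rw [expect_prodFamily_totalNumber hLa hLb haL hbL hφ hφ1, hcast, Complex.re_ofReal_mul, hL2]
    field_simp
  · unfold expect
    rw [dWaveSourceTorusTT'_zero_tp, expect_prodFamily_dWaveSourceTorus hLa hLb haL hbL U μ h hφ hφ1, hcast,
      Complex.re_ofReal_mul, hL2]
    field_simp

end Rows

/-! ### The `hrows` interface: periodic trial rows on every admissible side -/

section HRows

variable {a b q L₀ : ℕ}

/-- **Periodic trial rows from an even unit cluster vector** (the `hrows` hypothesis of the TI bridge
`exists_isTranslationInvariant_density_eq_meanEnergy_sourced_eq_of_periodic_trialStates` and of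
`sourcedEnergyUpperRow_of_hrows`, REAL slots): for `a ∣ q`, `b ∣ q`, `a, b < L₀`, on every side `L ≥ L₀` with
`q ∣ L` there is a unit vector (the tiled product `⊗_R φ`) with `Re⟨ψ, Nψ⟩ = n·L²`,
`Re⟨ψ, A_L(μ,h)ψ⟩ = e·L²`, `n = Re⟨φ, N_Cφ⟩/(ab)`, `e = Re⟨φ, A_C(μ,h)φ⟩/(ab)`. [cite: Ruelle1969, §3.3] -/
theorem periodicTrialRows_of_clusterState (hqa : a ∣ q) (hqb : b ∣ q) (hLa0 : a < L₀) (hLb0 : b < L₀)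
    (U μ h : ℝ) {φ : Fock (Orb (Fin a ×ₗ Fin b))} (hφ : HasParity 0 φ) (hφ1 : star φ ⬝ᵥ φ = 1) :
    ∀ L : ℕ, q ∣ L → L₀ ≤ L → ∀ [NeZero L], ∃ ψ : Fock (Orb (FermionTorus 2 L)),
      star ψ ⬝ᵥ ψ = 1 ∧
        (expect totalNumber ψ).re = (expect totalNumber φ).re / ((a : ℝ) * b) * (L : ℝ) ^ 2 ∧
        (expect (dWaveSourceTorusTT' L 0 U μ h) ψ).re =
          (expect (dWaveSourceOpenBox a b U μ h) φ).re / ((a : ℝ) * b) * (L : ℝ) ^ 2 := by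
  intro L hqL hL _
  obtain ⟨Kx, hKx⟩ := hqa.trans hqL
  obtain ⟨Ky, hKy⟩ := hqb.trans hqL
  have hLa : L = Kx * a := by rw [hKx, mul_comm]
  have hLb : L = Ky * b := by rw [hKy, mul_comm]
  exact ⟨(rectBlockPartition hLa hLb).prodFamily fun _ => φ,
    trialRows_prodFamily hLa hLb (lt_of_lt_of_le hLa0 hL) (lt_of_lt_of_le hLb0 hL) U μ h hφ hφ1⟩

/-- **Periodic trial rows, RATIONAL slots** (the shape `sourcedEnergyUpperRow_of_hrows[_self|_zero]` reads, at
`μ = ((μ₀ : ℚ) : ℝ)`): given the cluster rows `Re⟨φ, N_Cφ⟩ = n·(ab)` and `Re⟨φ, A_C(μ₀,h)φ⟩ = e·(ab)` with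
`n, e : ℚ`. [cite: Ruelle1969, §3.3] -/
theorem periodicTrialRows_of_clusterState_rat (hqa : a ∣ q) (hqb : b ∣ q) (hLa0 : a < L₀) (hLb0 : b < L₀)
    (U h : ℝ) (μ₀ : ℚ) {φ : Fock (Orb (Fin a ×ₗ Fin b))} (hφ : HasParity 0 φ) (hφ1 : star φ ⬝ᵥ φ = 1)
    {n e : ℚ} (hn : (expect totalNumber φ).re = ((n : ℚ) : ℝ) * ((a : ℝ) * b))
    (he : (expect (dWaveSourceOpenBox a b U ((μ₀ : ℚ) : ℝ) h) φ).re = ((e : ℚ) : ℝ) * ((a : ℝ) * b)) :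
    ∀ L : ℕ, q ∣ L → L₀ ≤ L → ∀ [NeZero L], ∃ ψ : Fock (Orb (FermionTorus 2 L)),
      star ψ ⬝ᵥ ψ = 1 ∧ (expect totalNumber ψ).re = ((n : ℚ) : ℝ) * (L : ℝ) ^ 2 ∧
        (expect (dWaveSourceTorusTT' L 0 U ((μ₀ : ℚ) : ℝ) h) ψ).re = ((e : ℚ) : ℝ) * (L : ℝ) ^ 2 := by
  intro L hqL hL _
  obtain ⟨ψ, h1, hN, hE⟩ := periodicTrialRows_of_clusterState hqa hqb hLa0 hLb0 U ((μ₀ : ℚ) : ℝ) h hφ hφ1 L hqL hL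
  have hab : ((a : ℝ) * b) ≠ 0 := by
    have ha' : 0 < a := Nat.pos_of_ne_zero fun h0 => by
      rw [h0] at hqa; exact NeZero.ne L (Nat.eq_zero_of_zero_dvd (hqa.trans hqL))
    have hb' : 0 < b := Nat.pos_of_ne_zero fun h0 => by
      rw [h0] at hqb; exact NeZero.ne L (Nat.eq_zero_of_zero_dvd (hqb.trans hqL))
    positivity
  refine ⟨ψ, h1, ?_, ?_⟩
  · rw [hN, hn, mul_div_assoc, div_self hab, mul_one]
  · rw [hE, he, mul_div_assoc, div_self hab, mul_one]

/-- The `4 × 3` instance (`q = L₀ = 12`), rational slots: the shape of the hubbard-cq pilot's cluster rows.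
[cite: Ruelle1969, §3.3] -/
theorem periodicTrialRows_of_clusterState_4x3 (U h : ℝ) (μ₀ : ℚ) {φ : Fock (Orb (Fin 4 ×ₗ Fin 3))}
    (hφ : HasParity 0 φ) (hφ1 : star φ ⬝ᵥ φ = 1) {n e : ℚ}
    (hn : (expect totalNumber φ).re = ((n : ℚ) : ℝ) * ((4 : ℕ) * ((3 : ℕ) : ℝ)))
    (he : (expect (dWaveSourceOpenBox 4 3 U ((μ₀ : ℚ) : ℝ) h) φ).re = ((e : ℚ) : ℝ) * ((4 : ℕ) * ((3 : ℕ) : ℝ))) :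
    ∀ L : ℕ, 12 ∣ L → 12 ≤ L → ∀ [NeZero L], ∃ ψ : Fock (Orb (FermionTorus 2 L)),
      star ψ ⬝ᵥ ψ = 1 ∧ (expect totalNumber ψ).re = ((n : ℚ) : ℝ) * (L : ℝ) ^ 2 ∧
        (expect (dWaveSourceTorusTT' L 0 U ((μ₀ : ℚ) : ℝ) h) ψ).re = ((e : ℚ) : ℝ) * (L : ℝ) ^ 2 :=
  periodicTrialRows_of_clusterState_rat (by norm_num) (by norm_num) (by norm_num) (by norm_num) U h μ₀ hφ hφ1 hn he

end HRows

end Summit.Ventures.CertifiedManyBodySolver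

end
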